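import Mathlib.Combinatorics.SetFamily.FourFunctions
import Mathlib.Tactic
import HarnessLib
import HarnessLib.Audit.Tags
import Summits.CriticalPhenomena.PercolationContinuityZ3.Theorems.PercNearOneGluingNoHeavyLowerTailSahiColouredDaykin
import Summits.CriticalPhenomena.PercolationContinuityZ3.Theorems.PercNearOneGluingNoHeavyLowerTailSahiColouredDaykinTwoColours

/-!
# Crossing signed coloured Daykin with a singleton colour class, from a strict Marica–Schönheim inequality

Support file (seat `prim-masterthm-p1`, gen 28; `--supports stmt-CriticalPhenomena-4575`).  One new `Prop` (the conjecture
`StrictMaricaSchonheim`), no `sorry`, standard axioms.  Memo `run/shared/lean/prim/prim-masterthm/FROM-prim-masterthm-p1-g28-STRONG-DAYKIN.md` §17.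

CONTEXT.  `…SahiColouredDaykinCross` (p396572) shows that the three-petal refined Gladkov count needs the signed coloured Daykin inequality only for
CROSSING configurations (`CrossSignedColouredDaykin3`).  In every petal-derived three-colour configuration enumerated on `2^5`, and in all but a
handful sampled on `2^6`, the smallest colour class is a SINGLETON.  This file isolates what that case needs:

* `StrictMaricaSchonheim` — **conjecture (strict Marica–Schönheim for disconnected families):** if `𝒜, ℬ` are non-empty families with no member of `𝒜`
  comparable to a member of `ℬ`, then the differences of `𝒜 ∪ ℬ` number at least `#𝒜 + #ℬ + 1` (one more than Marica–Schönheim).  Exhaustive on `2^3`,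
  `2^4` (all 4 493 disconnected families), adversarially 0 failures on `2^5`, `2^6`; numerically the equality families of Marica–Schönheim are exactly
  the (translated, blown-up) products "up-set × down-set", all of which are connected (memo §17; cf. Aharoni–Holzman, J. LMS 48 (1993)).
* `card_le_card_compatJoins_cross_two_colours` — under `StrictMaricaSchonheim`: a crossing configuration using exactly two colours, both present, has
  `#P + 1 ≤ #compatJoins` (slack ≥ 1).  Proof: `Q = A ∪ B̃` (one class complemented) is disconnected by crossing (`a ⊄ F\b` since `a ∩ b ≠ ∅`,
  `F\b ⊄ a` since `a ∪ b ≠ F`), and every difference of `Q` is the complement of a compatible union.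
* `card_le_card_compatJoins_cross_of_singleton` — under `StrictMaricaSchonheim`: **a crossing three-colour configuration one of whose colour classes
  is a singleton satisfies `#P ≤ #compatJoins F P c`** (drop the singleton, use the two-colour slack, monotonicity of `compatJoins`).

HONEST FRAMING: conditional on the stated conjecture; unconditional for nothing new. [this work]
-/

namespace Summit.CriticalPhenomena.PercolationContinuityZ3.Theorems.SahiColouredDaykin

open Finset
open scoped FinsetFamily

variable {α : Type*} [DecidableEq α]

/-! ### 1. The strict Marica–Schönheim conjecture -/

/-- **CONJECTURE (strict Marica–Schönheim for disconnected families).**  If `𝒜` and `ℬ` are non-empty finite families of finite sets and no member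
of `𝒜` is comparable with a member of `ℬ`, then `#𝒜 + #ℬ + 1 ≤ #((𝒜 ∪ ℬ) \\ (𝒜 ∪ ℬ))`.  (Marica–Schönheim gives `#𝒜 + #ℬ`; the conjecture says
equality forces a connected comparability graph.)  Exhaustive on `2^≤4`, adversarially tested on `2^5, 2^6`. [this work] [status: open] -/
@[conjecture] def StrictMaricaSchonheim (α : Type*) [DecidableEq α] : Prop :=
  ∀ (𝒜 ℬ : Finset (Finset α)), 𝒜.Nonempty → ℬ.Nonempty →
    (∀ a ∈ 𝒜, ∀ b ∈ ℬ, ¬ a ⊆ b ∧ ¬ b ⊆ a) → #𝒜 + #ℬ + 1 ≤ #((𝒜 ∪ ℬ) \\ (𝒜 ∪ ℬ))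

/-! ### 2. Two colours with crossing: slack one -/

/-- Complementation inside `F` is injective on subfamilies of `2^F`. [folklore] -/
private theorem sdiff_injOn' (F : Finset α) (𝒜 : Finset (Finset α)) (h𝒜 : ∀ S ∈ 𝒜, S ⊆ F) :
    Set.InjOn (fun S => F \ S) ↑𝒜 := by
  intro S hS S' hS' h
  have hSF := h𝒜 S (mem_coe.1 hS)
  have hS'F := h𝒜 S' (mem_coe.1 hS')
  have : F \ (F \ S) = F \ (F \ S') := by
    show F \ ((fun S => F \ S) S) = F \ ((fun S => F \ S) S')
    rw [h]
  rwa [Finset.sdiff_sdiff_eq_self hSF, Finset.sdiff_sdiff_eq_self hS'F] at this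

/-- **Two colours, crossing ⟹ slack one (under `StrictMaricaSchonheim`).**  If `P ⊆ 2^F` is crossing (any two members meet and do not cover `F`),
uses only the colours `i ≠ j`, and both occur, then `#P + 1 ≤ #(compatJoins F P c)`. [this work] -/
theorem card_le_card_compatJoins_cross_two_colours (hMS : StrictMaricaSchonheim α)
    (F : Finset α) (P : Finset (Finset α)) (c : Finset α → Fin 3) (i j : Fin 3) (hij : i ≠ j)
    (hPF : ∀ S ∈ P, S ⊆ F) (hcol : ∀ S ∈ P, c S = i ∨ c S = j)
    (hi : ∃ S ∈ P, c S = i) (hj : ∃ S ∈ P, c S = j)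
    (hcross : ∀ S ∈ P, ∀ T ∈ P, (S ∩ T).Nonempty ∧ S ∪ T ≠ F) :
    #P + 1 ≤ #(compatJoins F P c) := by
  classical
  set A := P.filter fun S => c S = i with hA
  set B := P.filter fun S => c S = j with hB
  set Bc : Finset (Finset α) := B.image fun S => F \ S with hBc
  -- sizes
  have hAB : #A + #B = #P := by
    have hBeq : B = P.filter fun S => ¬ c S = i := by
      rw [hB]
      apply filter_congr
      intro S hS
      constructor
      · intro h h'; rw [h'] at h; exact hij h
      · intro h; exact (hcol S hS).resolve_left h
    rw [hBeq, hA]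
    exact card_filter_add_card_filter_not _
  have hBc_card : #Bc = #B := card_image_of_injOn (sdiff_injOn' F B fun S hS => hPF S (mem_filter.1 hS).1)
  have hAne : A.Nonempty := by
    obtain ⟨S, hS, hSi⟩ := hi
    exact ⟨S, mem_filter.2 ⟨hS, hSi⟩⟩
  have hBcne : Bc.Nonempty := by
    obtain ⟨S, hS, hSj⟩ := hj
    exact ⟨F \ S, mem_image.2 ⟨S, mem_filter.2 ⟨hS, hSj⟩, rfl⟩⟩
  -- disconnectedness: no `a ∈ A` is comparable with an `F \ b`, `b ∈ B`
  have hdisc : ∀ a ∈ A, ∀ b' ∈ Bc, ¬ a ⊆ b' ∧ ¬ b' ⊆ a := by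
    intro a ha b' hb'
    obtain ⟨b, hb, rfl⟩ := mem_image.1 hb'
    have haP := (mem_filter.1 ha).1
    have hbP := (mem_filter.1 hb).1
    obtain ⟨hne, hcov⟩ := hcross a haP b hbP
    constructor
    · intro h
      obtain ⟨x, hx⟩ := hne
      obtain ⟨hxa, hxb⟩ := mem_inter.1 hx
      exact (mem_sdiff.1 (h hxa)).2 hxb
    · intro h
      apply hcov
      apply Subset.antisymm (union_subset (hPF a haP) (hPF b hbP))
      intro x hx
      by_cases hxb : x ∈ b
      · exact mem_union.2 (Or.inr hxb)
      · exact mem_union.2 (Or.inl (h (mem_sdiff.2 ⟨hx, hxb⟩)))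
  have hstrict := hMS A Bc hAne hBcne hdisc
  -- every difference of `A ∪ Bc` is the complement of a compatible union
  set Q := A ∪ Bc with hQ
  have hmem : ∀ Z ∈ Q \\ Q, Z ⊆ F ∧ F \ Z ∈ compatJoins F P c := by
    intro Z hZ
    obtain ⟨X, hX, Y, hY, rfl⟩ := mem_diffs.1 hZ
    rcases mem_union.1 hX with hX | hX <;> rcases mem_union.1 hY with hY | hY
    · -- a \ a'
      obtain ⟨haP, hai⟩ := mem_filter.1 hX
      obtain ⟨ha'P, ha'i⟩ := mem_filter.1 hY
      refine ⟨sdiff_subset.trans (hPF X haP), ?_⟩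
      have e : F \ (X \ Y) = Y ∪ (F \ X) := by
        ext x
        have h1 : x ∈ Y → x ∈ F := fun h => hPF Y ha'P h
        simp only [mem_sdiff, mem_union]
        tauto
      rw [e]
      exact union_sdiff_mem_compatJoins ha'P haP (by rw [ha'i, hai])
    · -- a \ (F \ b) = a ∩ b
      obtain ⟨haP, hai⟩ := mem_filter.1 hX
      obtain ⟨b, hb, rfl⟩ := mem_image.1 hY
      obtain ⟨hbP, hbj⟩ := mem_filter.1 hb
      refine ⟨sdiff_subset.trans (hPF X haP), ?_⟩
      have e : F \ (X \ (F \ b)) = (F \ X) ∪ (F \ b) := by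
        ext x
        have h1 : x ∈ X → x ∈ F := fun h => hPF X haP h
        simp only [mem_sdiff, mem_union]
        tauto
      rw [e]
      exact sdiff_union_sdiff_mem_compatJoins haP hbP (by rw [hai, hbj]; exact hij)
    · -- (F \ b) \ a = F \ (a ∪ b)
      obtain ⟨b, hb, rfl⟩ := mem_image.1 hX
      obtain ⟨hbP, hbj⟩ := mem_filter.1 hb
      obtain ⟨haP, hai⟩ := mem_filter.1 hY
      refine ⟨sdiff_subset.trans sdiff_subset, ?_⟩
      have e : F \ ((F \ b) \ Y) = Y ∪ b := by
        ext x
        have h1 : x ∈ Y → x ∈ F := fun h => hPF Y haP h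
        have h2 : x ∈ b → x ∈ F := fun h => hPF b hbP h
        simp only [mem_sdiff, mem_union]
        tauto
      rw [e]
      exact union_mem_compatJoins haP hbP (by rw [hai, hbj]; exact hij)
    · -- (F \ b) \ (F \ b') = b' \ b
      obtain ⟨b, hb, rfl⟩ := mem_image.1 hX
      obtain ⟨hbP, hbj⟩ := mem_filter.1 hb
      obtain ⟨b', hb', rfl⟩ := mem_image.1 hY
      obtain ⟨hb'P, hb'j⟩ := mem_filter.1 hb'
      refine ⟨sdiff_subset.trans sdiff_subset, ?_⟩
      have e : F \ ((F \ b) \ (F \ b')) = b ∪ (F \ b') := by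
        ext x
        have h2 : x ∈ b → x ∈ F := fun h => hPF b hbP h
        simp only [mem_sdiff, mem_union]
        tauto
      rw [e]
      exact union_sdiff_mem_compatJoins hbP hb'P (by rw [hbj, hb'j])
  have hinj : Set.InjOn (fun Z => F \ Z) ↑(Q \\ Q) := sdiff_injOn' F (Q \\ Q) fun Z hZ => (hmem Z hZ).1
  have hsub : (Q \\ Q).image (fun Z => F \ Z) ⊆ compatJoins F P c := by
    intro W hW
    obtain ⟨Z, hZ, rfl⟩ := mem_image.1 hW
    exact (hmem Z hZ).2
  calc #P + 1 = #A + #Bc + 1 := by rw [hBc_card, hAB]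
    _ ≤ #(Q \\ Q) := hstrict
    _ = #((Q \\ Q).image fun Z => F \ Z) := (card_image_of_injOn hinj).symm
    _ ≤ #(compatJoins F P c) := card_le_card hsub

/-! ### 3. Three colours with a singleton class -/

/-- **Crossing configurations with a singleton colour class (under `StrictMaricaSchonheim`).**  If `P ⊆ 2^F` is crossing (members of different
colours incomparable; any two members meet and do not cover `F`), all three colours occur and the colour `i` occurs exactly once, then
`#P ≤ #(compatJoins F P c)`: drop the `i`-member, apply the two-colour slack, and use monotonicity of `compatJoins`. [this work] -/
theorem card_le_card_compatJoins_cross_of_singleton (hMS : StrictMaricaSchonheim α)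
    (F : Finset α) (P : Finset (Finset α)) (c : Finset α → Fin 3) (i : Fin 3)
    (hPF : ∀ S ∈ P, S ⊆ F)
    (hcross : ∀ S ∈ P, ∀ T ∈ P, (S ∩ T).Nonempty ∧ S ∪ T ≠ F)
    (hone : #(P.filter fun S => c S = i) = 1)
    (hall : ∀ j : Fin 3, ∃ S ∈ P, c S = j) : #P ≤ #(compatJoins F P c) := by
  classical
  set P' := P.filter fun S => ¬ c S = i with hP'
  have hsub : P' ⊆ P := filter_subset _ _
  have hcard : #P = #P' + 1 := by
    have := card_filter_add_card_filter_not (s := P) (fun S => c S = i)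
    rw [hone] at this
    rw [hP']
    omega
  -- the two remaining colours
  have hij1 : i ≠ i + 1 := by
    have : ∀ x : Fin 3, x ≠ x + 1 := by decide
    exact this i
  have hij2 : i ≠ i + 2 := by
    have : ∀ x : Fin 3, x ≠ x + 2 := by decide
    exact this i
  have h12 : i + 1 ≠ i + 2 := by
    have : ∀ x : Fin 3, x + 1 ≠ x + 2 := by decide
    exact this i
  have hcol : ∀ S ∈ P', c S = i + 1 ∨ c S = i + 2 := by
    intro S hS
    have hne : c S ≠ i := (mem_filter.1 hS).2
    have : ∀ x y : Fin 3, y ≠ x → y = x + 1 ∨ y = x + 2 := by decide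
    exact this i (c S) hne
  have h1 : ∃ S ∈ P', c S = i + 1 := by
    obtain ⟨S, hS, hc⟩ := hall (i + 1)
    exact ⟨S, mem_filter.2 ⟨hS, by rw [hc]; exact hij1.symm⟩, hc⟩
  have h2 : ∃ S ∈ P', c S = i + 2 := by
    obtain ⟨S, hS, hc⟩ := hall (i + 2)
    exact ⟨S, mem_filter.2 ⟨hS, by rw [hc]; exact hij2.symm⟩, hc⟩
  have htwo := card_le_card_compatJoins_cross_two_colours hMS F P' c (i + 1) (i + 2) h12
    (fun S hS => hPF S (hsub hS)) hcol h1 h2 (fun S hS T hT => hcross S (hsub hS) T (hsub hT))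
  calc #P = #P' + 1 := hcard
    _ ≤ #(compatJoins F P' c) := htwo
    _ ≤ #(compatJoins F P c) := card_le_card (compatJoins_mono F hsub c)

end Summit.CriticalPhenomena.PercolationContinuityZ3.Theorems.SahiColouredDaykin
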